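import Summits.MatrixMultiplication.MatrixMultiplication.Theses.MarginalColumns
import Literature.Computability.AlgebraicComplexity.BorderRankMatMulRectangular

/-!
# Load-bearing analysis of the crux `MarginalColumns.SecondColumnCheap` (C)

Crux `MarginalColumns.SecondColumnCheap` (stmt-MatrixMultiplication-16309), refuter lane
(`Theorems/SecondColumnCheap/Negative/`; crux-attack vetting at birth, 2026-08-17). The crux reads,
verbatim (`crux_iff`): for every `ε > 0` there is `C` with `bR⟨n,n,2⟩ ≤ n² + C·n^{1+ε}` for all
`n ≥ 1`, where `bR⟨n,n,2⟩ = algBorderRank (matMulTensor ℂ n n 2)` (an `n × n` matrix times an `n × 2`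
one; Bläser's border rank over `ℂ[ε]`). Recorded here, sorry-free, axioms standard:

* `borderRank_nn2_eq_2nn` — the crux's tensor has the border rank of CHL's `M_⟨2,n,n⟩` (cyclic
  symmetry, tree), so the vendored facts of `BorderRankMatMulRectangular` speak about the crux verbatim.
* `sandwich` — the in-tree window `n² ≤ bR⟨n,n,2⟩ ≤ 2n²` (flattening / standard algorithm): the crux
  (excess `n^{1+o(1)}`) is neither vacuous nor settled by anything in tree (excess `0 … n²`).
* `two_le_borderRank_112`, `one_le_const` — `bR⟨1,1,2⟩ ≥ 2`: the trivial witness `C = 0` fails at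
  `n = 1`, every admissible constant has `C ≥ 1`.
* `instance_zero` — the `n = 0` instance holds for every `C`: the hypothesis `1 ≤ n` is decoration.
* `instance_of_one_le_eps`, `secondColumnCheap_iff_unit_interval` — for `ε ≥ 1` the instance is the
  trivial bound; the whole content of C is the window `0 < ε < 1`.
* `anyEps_false_of_CHL` — the hypothesis `0 < ε` is LOAD-BEARING: with it dropped (witness `ε = -1`)
  the statement contradicts the printed lower bound `bR⟨2,n,n⟩ ≥ n² + 1.32 n + 1` (`n ≥ 25`,
  Conner–Harper–Landsberg 2023 Thm 1.4(3), a named fact of the tree, taken as hypothesis). The endpoint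
  `ε = 0` (`bR⟨n,n,2⟩ ≤ n² + C·n`; hollow-schoolbook law `n² + 2n − 1`) stays open.
* `secondColumnCheap_iff_eventually` — C is insensitive to every finite set of cells (a tail version
  from any `N` on is equivalent): no finite computation decides C either way.
* `borderRank_mul_le` — Kronecker monotonicity `bR⟨nk,nk,2⟩ ≤ k²·bR⟨n,n,2⟩`: one cell with ratio
  `ρ = bR⟨n₀,n₀,2⟩/n₀²` gives `≤ ρ m²` on all multiples, never the `1 + o(1)` of C.
* `secondColumnCheap_false_of_secondColumnGrowth` — the route's kill criterion, checked:
  `SecondColumnGrowth → ¬ SecondColumnCheap` (bulk growth `(1+c)n²` against `ε = 1/2`).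

No theorem here asserts a Theses decl positively.
-/

-- single-conjunct summit: the mandated namespace repeats a component (dupNamespace linter).
set_option linter.dupNamespace false

namespace Summit.MatrixMultiplication.MatrixMultiplication.Theorems.SecondColumnCheap.Negative

open Literature.Computability.AlgebraicComplexity
open Summit.MatrixMultiplication.MatrixMultiplication.Theses.MarginalColumns

/-- Read-back: the crux unfolds, by `Iff.rfl`, to the verbatim body below. -/
theorem crux_iff : SecondColumnCheap ↔
    ∀ ε : ℝ, 0 < ε → ∃ C : ℝ, ∀ n : ℕ, 1 ≤ n →
      (algBorderRank (matMulTensor ℂ n n 2) : ℝ) ≤ (n : ℝ) ^ 2 + C * (n : ℝ) ^ (1 + ε) := Iff.rfl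

/-- The crux's format `⟨n,n,2⟩` and CHL's `M_⟨2,n,n⟩` have the same border rank (cyclic symmetry). -/
theorem borderRank_nn2_eq_2nn (n : ℕ) :
    algBorderRank (matMulTensor ℂ n n 2) = algBorderRank (matMulTensor ℂ 2 n n) := by
  rw [algBorderRank_matMulTensor_rotate ℂ n n 2, algBorderRank_matMulTensor_rotate ℂ n 2 n]

/-- In-tree window: `n² ≤ bR⟨n,n,2⟩ ≤ 2n²` (flattening below, standard algorithm above). -/
theorem sandwich (n : ℕ) :
    n ^ 2 ≤ algBorderRank (matMulTensor ℂ n n 2) ∧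
      algBorderRank (matMulTensor ℂ n n 2) ≤ 2 * n ^ 2 := by
  constructor
  · have h := card_le_algBorderRank_of_linearIndependent _
      (linearIndependent_rotate_matMulTensor ℂ n n 2)
    rw [algBorderRank_rotate] at h
    simpa [Fintype.card_prod, Fintype.card_fin, sq] using h
  · calc algBorderRank (matMulTensor ℂ n n 2) ≤ tensorRank (matMulTensor ℂ n n 2) :=
          algBorderRank_le_tensorRank _
      _ ≤ n * n * 2 := tensorRank_matMulTensor_le ℂ n n 2
      _ = 2 * n ^ 2 := by ring

/-- Flattening on the output factor: `2 ≤ bR⟨1,1,2⟩`. -/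
theorem two_le_borderRank_112 : 2 ≤ algBorderRank (matMulTensor ℂ 1 1 2) := by
  have h := card_le_algBorderRank_of_linearIndependent _ (linearIndependent_matMulTensor ℂ 1 1 2)
  simpa [Fintype.card_prod, Fintype.card_fin] using h

/-- Hence the trivial witness `C = 0` fails at `n = 1`, and every admissible constant has `1 ≤ C`. -/
theorem one_le_const (ε C : ℝ)
    (h : ∀ n : ℕ, 1 ≤ n →
      (algBorderRank (matMulTensor ℂ n n 2) : ℝ) ≤ (n : ℝ) ^ 2 + C * (n : ℝ) ^ (1 + ε)) :
    1 ≤ C := by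
  have h1 := h 1 le_rfl
  have h2 : (2 : ℝ) ≤ (algBorderRank (matMulTensor ℂ 1 1 2) : ℝ) := by
    exact_mod_cast two_le_borderRank_112
  simp at h1
  linarith

/-- Degenerate instance `n = 0`: holds for every `C` and every `ε > 0` (empty index types, border rank
`0`; `0 ^ (1+ε) = 0`), so the hypothesis `1 ≤ n` of the crux is decoration. -/
theorem instance_zero (ε C : ℝ) (hε : 0 < ε) :
    (algBorderRank (matMulTensor ℂ 0 0 2) : ℝ) ≤ ((0 : ℕ) : ℝ) ^ 2 + C * ((0 : ℕ) : ℝ) ^ (1 + ε) := by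
  have h0 : algBorderRank (matMulTensor ℂ 0 0 2) = 0 := by simpa using (sandwich 0).2
  rw [h0]
  have hne : (1 + ε) ≠ 0 := by linarith
  simp [Real.zero_rpow hne]

/-- Trivial regime: for `ε ≥ 1` the instance holds with `C = 1` (`bR⟨n,n,2⟩ ≤ 2n² ≤ n² + n^{1+ε}`). -/
theorem instance_of_one_le_eps (ε : ℝ) (hε : 1 ≤ ε) (n : ℕ) (hn : 1 ≤ n) :
    (algBorderRank (matMulTensor ℂ n n 2) : ℝ) ≤ (n : ℝ) ^ 2 + 1 * (n : ℝ) ^ (1 + ε) := by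
  have hup : (algBorderRank (matMulTensor ℂ n n 2) : ℝ) ≤ 2 * (n : ℝ) ^ 2 := by
    exact_mod_cast (sandwich n).2
  have hn1 : (1 : ℝ) ≤ n := by exact_mod_cast hn
  have hpow : (n : ℝ) ^ 2 ≤ (n : ℝ) ^ (1 + ε) := by
    rw [show (n : ℝ) ^ 2 = (n : ℝ) ^ ((2 : ℕ) : ℝ) by rw [Real.rpow_natCast]]
    exact Real.rpow_le_rpow_of_exponent_le hn1 (by push_cast; linarith)
  linarith

/-- The whole content of C is the window `0 < ε < 1`. -/
theorem secondColumnCheap_iff_unit_interval : SecondColumnCheap ↔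
    ∀ ε : ℝ, 0 < ε → ε < 1 → ∃ C : ℝ, ∀ n : ℕ, 1 ≤ n →
      (algBorderRank (matMulTensor ℂ n n 2) : ℝ) ≤ (n : ℝ) ^ 2 + C * (n : ℝ) ^ (1 + ε) := by
  constructor
  · exact fun h ε hε _ => h ε hε
  · intro h ε hε
    rcases lt_or_ge ε 1 with hlt | hge
    · exact h ε hε hlt
    · exact ⟨1, fun n hn => instance_of_one_le_eps ε hge n hn⟩

/-- `0 < ε` is LOAD-BEARING: the crux with that hypothesis dropped is false, modulo the printed fact
CHL 2023 Thm 1.4(3) (`n² + 1.32 n + 1 ≤ bR⟨2,n,n⟩` for `n ≥ 25`; a named fact, not proved in tree):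
the witness `ε = -1` would give `bR⟨n,n,2⟩ ≤ n² + C` for all `n`. -/
theorem anyEps_false_of_CHL (hCHL : ConnerHarperLandsberg2023_thm_1_4_2nn_asymptotic) :
    ¬ (∀ ε : ℝ, ∃ C : ℝ, ∀ n : ℕ, 1 ≤ n →
        (algBorderRank (matMulTensor ℂ n n 2) : ℝ) ≤ (n : ℝ) ^ 2 + C * (n : ℝ) ^ (1 + ε)) := by
  intro h
  obtain ⟨C, hC⟩ := h (-1)
  obtain ⟨n, hn⟩ := exists_nat_gt (max 25 |C|)
  have hn25 : 25 ≤ n := by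
    have : (25 : ℝ) < n := lt_of_le_of_lt (le_max_left _ _) hn
    exact_mod_cast this.le
  have hnC : |C| < n := lt_of_le_of_lt (le_max_right _ _) hn
  have h1 := hC n (by omega)
  have h2 := hCHL n hn25
  rw [← borderRank_nn2_eq_2nn] at h2
  have hpow : (n : ℝ) ^ (1 + (-1 : ℝ)) = 1 := by norm_num
  rw [hpow, mul_one] at h1
  have hCle : C ≤ |C| := le_abs_self C
  have hn0 : (0 : ℝ) ≤ n := Nat.cast_nonneg n
  nlinarith

/-- C is a TAIL statement: for any `N`, bounding the cells `n ≥ N` is equivalent (the finitely many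
cells below `N` are absorbed into the constant via `bR⟨n,n,2⟩ ≤ 2n²`). In particular no finite
computation of border ranks decides C either way. -/
theorem secondColumnCheap_iff_eventually (N : ℕ) (hN : 1 ≤ N) : SecondColumnCheap ↔
    ∀ ε : ℝ, 0 < ε → ∃ C : ℝ, ∀ n : ℕ, N ≤ n →
      (algBorderRank (matMulTensor ℂ n n 2) : ℝ) ≤ (n : ℝ) ^ 2 + C * (n : ℝ) ^ (1 + ε) := by
  constructor
  · intro h ε hε
    obtain ⟨C, hC⟩ := h ε hε
    exact ⟨C, fun n hn => hC n (hN.trans hn)⟩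
  · intro h ε hε
    obtain ⟨C, hC⟩ := h ε hε
    refine ⟨max C 0 + N, fun n hn => ?_⟩
    have hn0 : (0 : ℝ) < n := by exact_mod_cast (show 0 < n by omega)
    have hn1 : (1 : ℝ) ≤ n := by exact_mod_cast hn
    have hrp : (n : ℝ) ≤ (n : ℝ) ^ (1 + ε) := by
      calc (n : ℝ) = (n : ℝ) ^ (1 : ℝ) := (Real.rpow_one _).symm
        _ ≤ (n : ℝ) ^ (1 + ε) := Real.rpow_le_rpow_of_exponent_le hn1 (by linarith)
    have hrp0 : 0 ≤ (n : ℝ) ^ (1 + ε) := Real.rpow_nonneg hn0.le _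
    rcases le_or_gt N n with hle | hlt
    · have h1 := hC n hle
      have : C * (n : ℝ) ^ (1 + ε) ≤ (max C 0 + N) * (n : ℝ) ^ (1 + ε) :=
        mul_le_mul_of_nonneg_right ((le_max_left C 0).trans (by simp)) hrp0
      linarith
    · have hup : (algBorderRank (matMulTensor ℂ n n 2) : ℝ) ≤ 2 * (n : ℝ) ^ 2 := by
        exact_mod_cast (sandwich n).2
      have hnN : (n : ℝ) ≤ N := by exact_mod_cast hlt.le
      have hsq : (n : ℝ) ^ 2 ≤ (N : ℝ) * (n : ℝ) ^ (1 + ε) := by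
        calc (n : ℝ) ^ 2 = (n : ℝ) * n := sq _
          _ ≤ (N : ℝ) * (n : ℝ) ^ (1 + ε) := mul_le_mul hnN hrp hn0.le (Nat.cast_nonneg N)
      have hC0 : 0 ≤ max C 0 * (n : ℝ) ^ (1 + ε) := mul_nonneg (le_max_right _ _) hrp0
      nlinarith

/-- Kronecker monotonicity along multiples: `bR⟨nk,nk,2⟩ ≤ k² · bR⟨n,n,2⟩`
(`⟨nk,nk,2⟩ = ⟨n,n,2⟩ ⊠ ⟨k,k,1⟩` and `bR⟨k,k,1⟩ ≤ k²`, tree). -/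
theorem borderRank_mul_le (n k : ℕ) :
    algBorderRank (matMulTensor ℂ (n * k) (n * k) 2) ≤ k ^ 2 * algBorderRank (matMulTensor ℂ n n 2) := by
  have h := algBorderRank_matMulTensor_mul_le ℂ n n 2 k k 1
  rw [mul_one] at h
  have h1 : algBorderRank (matMulTensor ℂ k k 1) ≤ k ^ 2 :=
    (algBorderRank_le_tensorRank _).trans ((tensorRank_matMulTensor_le ℂ k k 1).trans
      (by rw [mul_one, sq]))
  calc algBorderRank (matMulTensor ℂ (n * k) (n * k) 2)
      ≤ algBorderRank (matMulTensor ℂ n n 2) * algBorderRank (matMulTensor ℂ k k 1) := h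
    _ ≤ algBorderRank (matMulTensor ℂ n n 2) * k ^ 2 := Nat.mul_le_mul_left _ h1
    _ = k ^ 2 * algBorderRank (matMulTensor ℂ n n 2) := by ring

/-- The route's kill criterion, checked: bulk growth `(1+c) n² ≤ bR⟨n,n,2⟩` for all large `n`
(route support `SecondColumnGrowth`, open) refutes C (instantiate C at `ε = 1/2`). -/
theorem secondColumnCheap_false_of_secondColumnGrowth (hG : SecondColumnGrowth) :
    ¬ SecondColumnCheap := by
  intro hC
  obtain ⟨c, hc, n₀, hG⟩ := hG
  obtain ⟨C, hCn⟩ := hC (1 / 2) (by norm_num)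
  set C' : ℝ := max C 0 with hC'
  have hC'0 : 0 ≤ C' := le_max_right _ _
  obtain ⟨n, hn⟩ := exists_nat_gt (max (n₀ : ℝ) ((C' / c) ^ 2 + 1))
  have hn₀ : n₀ ≤ n := by
    have : (n₀ : ℝ) < n := lt_of_le_of_lt (le_max_left _ _) hn
    exact_mod_cast this.le
  have hbig : (C' / c) ^ 2 + 1 < n := lt_of_le_of_lt (le_max_right _ _) hn
  have hn1 : 1 ≤ n := by
    have : (1 : ℝ) < n := by nlinarith [sq_nonneg (C' / c)]
    exact_mod_cast this.le
  have hnpos : (0 : ℝ) < n := by exact_mod_cast (show 0 < n by omega)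
  have h1 := hG n hn₀
  have h2 := hCn n hn1
  have h3 : c * (n : ℝ) ^ 2 ≤ C' * (n : ℝ) ^ (1 + 1 / 2 : ℝ) := by
    have : C * (n : ℝ) ^ (1 + 1 / 2 : ℝ) ≤ C' * (n : ℝ) ^ (1 + 1 / 2 : ℝ) :=
      mul_le_mul_of_nonneg_right (le_max_left _ _) (Real.rpow_nonneg hnpos.le _)
    nlinarith
  have hsplit : (n : ℝ) ^ 2 = (n : ℝ) ^ (1 + 1 / 2 : ℝ) * (n : ℝ) ^ (1 / 2 : ℝ) := by
    rw [← Real.rpow_add hnpos]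
    norm_num
  have hp : 0 < (n : ℝ) ^ (1 + 1 / 2 : ℝ) := Real.rpow_pos_of_pos hnpos _
  rw [hsplit] at h3
  have h4 : c * (n : ℝ) ^ (1 / 2 : ℝ) ≤ C' := by
    have h5 : (c * (n : ℝ) ^ (1 / 2 : ℝ)) * (n : ℝ) ^ (1 + 1 / 2 : ℝ) ≤
        C' * (n : ℝ) ^ (1 + 1 / 2 : ℝ) := by nlinarith
    exact le_of_mul_le_mul_right h5 hp
  have h6 : (n : ℝ) ^ (1 / 2 : ℝ) ≤ C' / c := by
    rw [le_div_iff₀ hc]; linarith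
  have h7 : (n : ℝ) ≤ (C' / c) ^ 2 := by
    have hs : 0 ≤ (n : ℝ) ^ (1 / 2 : ℝ) := Real.rpow_nonneg hnpos.le _
    have := mul_le_mul h6 h6 hs (by positivity)
    have e : (n : ℝ) ^ (1 / 2 : ℝ) * (n : ℝ) ^ (1 / 2 : ℝ) = n := by
      rw [← Real.rpow_add hnpos]; norm_num
    nlinarith
  linarith

end Summit.MatrixMultiplication.MatrixMultiplication.Theorems.SecondColumnCheap.Negative
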